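import Literature.Computability.ImplicitComplexity.SoftTypeAssignmentSubstFamily
import HarnessLib

/-!
# The substitution lemma of `STA₊`, II: the rules `(sp)`, `(∀I)`, `(⊸I)`, `(⊸E)`

Continuation of `SoftTypeAssignmentSubstFamily.lean` (GR07 = Gaboardi–Ronchi Della Rocca 2007,
GMR08 = Gaboardi–Marion–Ronchi Della Rocca 2008): the cases of the Substitution Lemma
(`STA.SubstGoal`) for a main derivation ending with

* `(sp)` — the substituends are used one level lower (their levels `ℓ` decrease by one), and the
  cost identity `r · Σₓ r^{ℓ x - 1} wt x = Σₓ r^{ℓ x} wt x` is exactly the weight `r · W` of the box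
  (`SubstGoal.sp`);
* `(∀I)` — the family is shifted in its type variables (`SubstGoal.allI`);
* `(⊸I)` — the family is shifted under the binder (`SubstGoal.lam`);
* `(⊸E)` — the family is split between function and argument according to the context split,
  the two result contexts being again a split (`SubstGoal.app`).

## References

* [GaboardiRonchiDellaRocca2007] GR07, Substitution Lemma.
* [GaboardiMarionRonchidellarocca2008] GMR08, Lemma 5.5.
-/

namespace Literature.Computability.ImplicitComplexity

namespace STA

open Finset

namespace SubstGoal

variable {r : ℕ}

/-! ### Case `(sp)` -/

/-- The substitution lemma through a soft promotion. [cite: GaboardiRonchiDellaRocca2007, Substitution Lemma] -/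
theorem sp {w d : ℕ} {Θ₀ : Ctx} {P : Term} {k : ℕ} {A : LinTy}
    (IH : SubstGoal r w d Θ₀ P ⟨k, A⟩) : SubstGoal r (r * w) (d + 1) Θ₀.bang P ⟨k + 1, A⟩ := by
  intro X N Δ c ℓ wt e F
  have hℓ : ∀ x ∈ X, 1 ≤ ℓ x := by
    intro x hx
    obtain ⟨B, hB, _⟩ := F.deriv x hx
    simp only [Ctx.bang] at hB
    cases hΘ : Θ₀ x with
    | none => simp [hΘ] at hB
    | some σ =>
      simp only [hΘ, Option.map_some, SoftTy.bang, Option.some.injEq, SoftTy.mk.injEq] at hB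
      omega
  have F₀ : Family r Θ₀ X N Δ c (fun x => ℓ x - 1) wt e :=
    { deriv := fun x hx => by
        obtain ⟨B, hB, hD⟩ := F.deriv x hx
        simp only [Ctx.bang] at hB
        cases hΘ : Θ₀ x with
        | none => simp [hΘ] at hB
        | some σ =>
          obtain ⟨m, C⟩ := σ
          simp only [hΘ, Option.map_some, SoftTy.bang, Option.some.injEq, SoftTy.mk.injEq] at hB
          obtain ⟨h1, rfl⟩ := hB
          refine ⟨C, ?_, hD⟩
          congr
          omega
      tight := F.tight
      disjoint := fun i hi => by simpa [Ctx.bang] using F.disjoint i hi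
      owned := F.owned }
  obtain ⟨w', d', hw', hd', hD⟩ := IH F₀
  refine ⟨r * w', d' + 1, ?_, ?_, (WTyping.sp hD rfl).of_eq_ctx ?_⟩
  · have hc : r * famCost r X (fun x => ℓ x - 1) wt = famCost r X ℓ wt := by
      rw [famCost, famCost, mul_sum]
      refine sum_congr rfl fun x hx => ?_
      have h1 := hℓ x hx
      rw [← mul_assoc, ← pow_succ']
      congr 2
      omega
    calc r * w' ≤ r * (w + famCost r X (fun x => ℓ x - 1) wt) := Nat.mul_le_mul_left _ hw'
      _ = r * w + famCost r X ℓ wt := by rw [mul_add, hc]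
  · rcases le_max_iff.1 hd' with h1 | h1
    · exact (Nat.succ_le_succ h1).trans (le_max_left _ _)
    · by_cases hX : X.Nonempty
      · obtain ⟨x, hx, hxe⟩ := exists_mem_eq_sup X hX (fun x => e x + (ℓ x - 1))
        have h2 : famDeg X (fun x => ℓ x - 1) e = e x + (ℓ x - 1) := hxe
        have h3 := hℓ x hx
        have : d' + 1 ≤ e x + ℓ x := by omega
        exact this.trans ((le_famDeg hx ℓ e).trans (le_max_right _ _))
      · rw [not_nonempty_iff_eq_empty] at hX
        subst hX
        simp only [famDeg, sup_empty, bot_eq_zero, nonpos_iff_eq_zero] at h1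
        subst h1
        exact (Nat.succ_le_succ (Nat.zero_le d)).trans (le_max_left _ _)
  · funext i
    by_cases hiX : i ∈ X
    · simp [resCtx_apply, Ctx.bang, hiX]
    · cases hΘ : Θ₀ i with
      | some σ => simp [resCtx_apply, Ctx.bang, hiX, hΘ]
      | none =>
        cases hΔ : Δ i with
        | none => simp [resCtx_apply, Ctx.bang, hiX, hΘ, hΔ]
        | some τ₀ =>
          have h1 := hℓ (c i) (F.owned i (by simp [hΔ]))
          have e1 : τ₀.bangs + (ℓ (c i) - 1) + 1 = τ₀.bangs + ℓ (c i) := by omega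
          simp [resCtx_apply, Ctx.bang, hiX, hΘ, hΔ, SoftTy.bang, e1]

/-! ### Case `(∀I)` -/

/-- The substitution lemma through a `(∀I)`. [cite: GaboardiRonchiDellaRocca2007, Substitution Lemma] -/
theorem allI {w d : ℕ} {Θ : Ctx} {P : Term} {A : LinTy} (IH : SubstGoal r w d Θ.shift P ⟨0, A⟩) :
    SubstGoal r w d Θ P ⟨0, .all A⟩ := by
  intro X N Δ c ℓ wt e F
  have F' : Family r Θ.shift X N Δ.shift c ℓ wt e :=
    { deriv := fun x hx => by
        obtain ⟨B, hB, hD⟩ := F.deriv x hx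
        refine ⟨B.rename Nat.succ, by simp [Ctx.shift, hB, SoftTy.shift], ?_⟩
        refine hD.shiftT.of_eq_ctx (funext fun i => ?_)
        by_cases h : c i = x <;> simp [Ctx.shift, h]
      tight := fun x hx i hi => F.tight x hx i (by
        simp only [Ctx.part_apply] at hi ⊢
        by_cases h : c i = x
        · simpa [Ctx.shift, h] using hi
        · simp [h] at hi)
      disjoint := fun i hi => by
        have : Δ i ≠ none := by simpa [Ctx.shift] using hi
        simp [Ctx.shift, F.disjoint i this]
      owned := fun i hi => F.owned i (by simpa [Ctx.shift] using hi) }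
  obtain ⟨w', d', hw', hd', hD⟩ := IH F'
  refine ⟨w', d', hw', hd', WTyping.allI hD (funext fun i => ?_)⟩
  by_cases hiX : i ∈ X
  · simp [resCtx_apply, Ctx.shift, hiX]
  · cases hΘ : Θ i with
    | some σ => simp [resCtx_apply, Ctx.shift, hiX, hΘ]
    | none =>
      cases hΔ : Δ i with
      | none => simp [resCtx_apply, Ctx.shift, hiX, hΘ, hΔ]
      | some τ₀ => simp [resCtx_apply, Ctx.shift, hiX, hΘ, hΔ, SoftTy.shift]

/-! ### Case `(⊸I)` -/

/-- The substitution lemma through an abstraction: the family is shifted under the binder.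
[cite: GaboardiRonchiDellaRocca2007, Substitution Lemma] -/
theorem lam {w d : ℕ} {Θ : Ctx} {P : Term} {k : ℕ} {B A : LinTy}
    (IH : SubstGoal r w d (Ctx.cons (some ⟨k, B⟩) Θ) P ⟨0, A⟩) :
    SubstGoal r (w + 1) d Θ (.lam P) ⟨0, .limp k B A⟩ := by
  intro X N Δ c ℓ wt e F
  have F' : Family r (Ctx.cons (some ⟨k, B⟩) Θ) (X.image Nat.succ) (shiftFam N) (Ctx.cons none Δ)
      (fun i => c i.pred + 1) (fun x => ℓ x.pred) (fun x => wt x.pred) (fun x => e x.pred) :=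
    { deriv := fun x' hx' => by
        obtain ⟨x, hx, rfl⟩ := mem_image.1 hx'
        obtain ⟨B', hB', hD⟩ := F.deriv x hx
        refine ⟨B', by simpa [Ctx.cons] using hB', ?_⟩
        refine hD.shift_succ.of_eq_ctx (funext fun i => ?_)
        cases i with
        | zero => simp [Ctx.cons]
        | succ i => simp [Ctx.cons]
      tight := fun x' hx' i hi => by
        obtain ⟨x, hx, rfl⟩ := mem_image.1 hx'
        cases i with
        | zero => simp [Ctx.cons] at hi
        | succ i =>
          have hi' : (Δ.part c x) i ≠ none := by simpa [Ctx.cons] using hi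
          exact Term.mem_fv_rename.2 ⟨i, F.tight x hx i hi', rfl⟩
      disjoint := fun i hi => by
        cases i with
        | zero => simp [Ctx.cons] at hi
        | succ i => exact F.disjoint i (by simpa [Ctx.cons] using hi)
      owned := fun i hi => by
        cases i with
        | zero => simp [Ctx.cons] at hi
        | succ i => exact mem_image.2 ⟨c i, F.owned i (by simpa [Ctx.cons] using hi), rfl⟩ }
  obtain ⟨w', d', hw', hd', hD⟩ := IH F'
  have hcost : famCost r (X.image Nat.succ) (fun x => ℓ x.pred) (fun x => wt x.pred) = famCost r X ℓ wt := by
    rw [famCost, sum_image fun x _ y _ h => Nat.succ_injective h]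
    rfl
  have hdeg : famDeg (X.image Nat.succ) (fun x => ℓ x.pred) (fun x => e x.pred) = famDeg X ℓ e := by
    rw [famDeg, sup_image]
    rfl
  rw [hcost] at hw'
  rw [hdeg] at hd'
  refine ⟨w' + 1, d', by omega, hd', ?_⟩
  have eT : (Term.lam P).substp (famSubst X N) =
      .lam (P.substp (famSubst (X.image Nat.succ) (shiftFam N))) := by
    simp only [Term.substp]
    rw [up_famSubst]
  rw [eT]
  refine WTyping.lam (hD.of_eq_ctx (funext fun i => ?_))
  cases i with
  | zero =>
    have h0 : (0 : ℕ) ∉ X.image Nat.succ := by simp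
    simp [resCtx_apply, Ctx.cons, h0]
  | succ i =>
    by_cases hiX : i ∈ X
    · have h1 : i + 1 ∈ X.image Nat.succ := mem_image.2 ⟨i, hiX, rfl⟩
      simp [resCtx_apply, Ctx.cons, hiX, h1]
    · have h1 : i + 1 ∉ X.image Nat.succ := by simpa using hiX
      cases hΘ : Θ i with
      | some σ => simp [resCtx_apply, Ctx.cons, hiX, h1, hΘ]
      | none =>
        cases hΔ : Δ i with
        | none => simp [resCtx_apply, Ctx.cons, hiX, h1, hΘ, hΔ]
        | some τ₀ => simp [resCtx_apply, Ctx.cons, hiX, h1, hΘ, hΔ]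

/-! ### Case `(⊸E)` -/

/-- The substitution lemma through an application: the family splits with the context.
[cite: GaboardiRonchiDellaRocca2007, Substitution Lemma] -/
theorem app {w₁ w₂ d₁ d₂ : ℕ} {Θ Θ₁ Θ₂ : Ctx} {M N₀ : Term} {k : ℕ} {B A : LinTy}
    (hs : Θ.Split Θ₁ Θ₂) (E₁ : WTyping r w₁ d₁ Θ₁ M ⟨0, .limp k B A⟩) (E₂ : WTyping r w₂ d₂ Θ₂ N₀ ⟨k, B⟩)
    (IH₁ : SubstGoal r w₁ d₁ Θ₁ M ⟨0, .limp k B A⟩) (IH₂ : SubstGoal r w₂ d₂ Θ₂ N₀ ⟨k, B⟩) :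
    SubstGoal r (w₁ + w₂ + 1) (max d₁ d₂) Θ (.app M N₀) ⟨0, A⟩ := by
  intro X N Δ c ℓ wt e F
  -- the two halves of the family
  have hX₁ : (X.filter fun x => Θ₁ x ≠ none) ⊆ X := filter_subset _ _
  have hX₂ : (X.filter fun x => Θ₂ x ≠ none) ⊆ X := filter_subset _ _
  have hdisj : Disjoint (X.filter fun x => Θ₁ x ≠ none) (X.filter fun x => Θ₂ x ≠ none) :=
    disjoint_left.2 fun x h1 h2 => by
      have a := (mem_filter.1 h1).2
      have b := (mem_filter.1 h2).2
      rcases hs x with ⟨_, h⟩ | ⟨h, _⟩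
      exacts [b h, a h]
  have F₁ := F.restrict hX₁ (Θ' := Θ₁) (fun x hx => (hs.left_of_ne_none (mem_filter.1 hx).2).1)
    (fun i hi _ => by
      rcases hs i with ⟨h1, _⟩ | ⟨h1, _⟩
      · rw [h1]; exact F.disjoint i hi
      · exact h1)
  have F₂ := F.restrict hX₂ (Θ' := Θ₂) (fun x hx => (hs.right_of_ne_none (mem_filter.1 hx).2).2)
    (fun i hi _ => by
      rcases hs i with ⟨_, h2⟩ | ⟨_, h2⟩
      · exact h2
      · rw [h2]; exact F.disjoint i hi)
  obtain ⟨w₁', d₁', hw₁, hd₁, hD₁⟩ := IH₁ F₁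
  obtain ⟨w₂', d₂', hw₂, hd₂, hD₂⟩ := IH₂ F₂
  have eM : M.substp (famSubst (X.filter fun x => Θ₁ x ≠ none) N) = M.substp (famSubst X N) :=
    Term.substp_congr_fv fun i hi => by
      have : (i ∈ X.filter fun x => Θ₁ x ≠ none) ↔ i ∈ X := by
        simp [mem_filter, E₁.ne_none_of_mem_fv hi]
      simp [famSubst, this]
  have eN : N₀.substp (famSubst (X.filter fun x => Θ₂ x ≠ none) N) = N₀.substp (famSubst X N) :=
    Term.substp_congr_fv fun i hi => by
      have : (i ∈ X.filter fun x => Θ₂ x ≠ none) ↔ i ∈ X := by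
        simp [mem_filter, E₂.ne_none_of_mem_fv hi]
      simp [famSubst, this]
  rw [eM] at hD₁
  rw [eN] at hD₂
  refine ⟨w₁' + w₂' + 1, max d₁' d₂', ?_, ?_, WTyping.app (fun i => ?_) hD₁ hD₂⟩
  · have : famCost r (X.filter fun x => Θ₁ x ≠ none) ℓ wt + famCost r (X.filter fun x => Θ₂ x ≠ none) ℓ wt
        ≤ famCost r X ℓ wt := by
      rw [famCost, famCost, ← sum_union hdisj]
      exact sum_le_sum_of_subset (union_subset hX₁ hX₂)
    omega
  · exact max_le (hd₁.trans (max_le_max (le_max_left _ _) (famDeg_mono hX₁ ℓ e)))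
      (hd₂.trans (max_le_max (le_max_right _ _) (famDeg_mono hX₂ ℓ e)))
  · -- the result contexts form a split
    simp only [resCtx_apply, Ctx.levelled_apply, mem_filter]
    by_cases hiX : i ∈ X
    · have hΔ : Δ i = none := F.Δ_eq_none (F.declared hiX)
      rcases hs i with ⟨h1, h2⟩ | ⟨h1, h2⟩
      · have hΘ₁ : Θ₁ i ≠ none := h1 ▸ F.declared hiX
        left
        constructor <;> simp [hiX, hΘ₁, h2, hΔ]
      · have hΘ₂ : Θ₂ i ≠ none := h2 ▸ F.declared hiX
        left
        constructor <;> simp [hiX, hΘ₂, h1, hΔ]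
    · rcases hs i with ⟨h1, h2⟩ | ⟨h1, h2⟩
      · cases hΘ : Θ i with
        | some σ =>
          have hΔ : Δ i = none := F.Δ_eq_none (by simp [hΘ])
          rw [hΘ] at h1
          left
          constructor <;> simp [hiX, h1, h2, hΔ]
        | none =>
          rw [hΘ] at h1
          cases hΔ : Δ i with
          | none =>
            left
            constructor <;> simp [hiX, h1, h2]
          | some τ₀ =>
            have hcX : c i ∈ X := F.owned i (by simp [hΔ])
            have hd := F.declared hcX
            rcases hs (c i) with ⟨e1, e2⟩ | ⟨e1, e2⟩
            · have hc1 : Θ₁ (c i) ≠ none := e1 ▸ hd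
              left
              constructor <;> simp [hiX, h1, h2, hcX, hc1, e2]
            · have hc2 : Θ₂ (c i) ≠ none := e2 ▸ hd
              right
              constructor <;> simp [hiX, h1, h2, hcX, hc2, e1]
      · cases hΘ : Θ i with
        | some σ =>
          have hΔ : Δ i = none := F.Δ_eq_none (by simp [hΘ])
          rw [hΘ] at h2
          right
          constructor <;> simp [hiX, h1, h2, hΔ]
        | none =>
          rw [hΘ] at h2
          cases hΔ : Δ i with
          | none =>
            left
            constructor <;> simp [hiX, h1, h2]
          | some τ₀ =>
            have hcX : c i ∈ X := F.owned i (by simp [hΔ])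
            have hd := F.declared hcX
            rcases hs (c i) with ⟨e1, e2⟩ | ⟨e1, e2⟩
            · have hc1 : Θ₁ (c i) ≠ none := e1 ▸ hd
              left
              constructor <;> simp [hiX, h1, h2, hcX, hc1, e2]
            · have hc2 : Θ₂ (c i) ≠ none := e2 ▸ hd
              right
              constructor <;> simp [hiX, h1, h2, hcX, hc2, e1]

end SubstGoal

end STA

end Literature.Computability.ImplicitComplexity
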